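import Mathlib
import HarnessLib
import Literature.Combinatorics.Additive.StepBeyondKempermanUniqueSums
import Literature.Combinatorics.Additive.StepBeyondKempermanClaimNineExclusions
import Literature.Combinatorics.Additive.KempermanStructureTheoremNecessity

/-!
# Grynkiewicz 2009, §6 Subcase 2: «the quasi-period from KST must be `G`» read off the COMPLEMENT of the
# sumset — a critical pair whose sumset is, up to one element, the complement of a generating set two
# steps away from quasi-periodic sets and from quasi-progressions cannot exist

[cite: Grynkiewicz2009, §6 Subcase 2 (proof of Thm 4.1, p. 31)] [tag: critical-pair] [tag: inverse-theorem]

Topic `Literature/Combinatorics/Additive`.  Cell `mm-stpp` (D-0046), seat `mm-stpp-lit` (gen 24); the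
port of D. J. Grynkiewicz, *A step beyond Kemperman's structure theorem*, Mathematika **55** (2009)
67–114 continued.  The companion of `StepBeyondKempermanSeventeenExcluded.lean` (where the generating,
nearly-non-quasi-periodic set is a SUMMAND); here it is the complement of the SUMSET, as in §6 Subcase 2
(print p. 31):

«Suppose `|A(e) + B(e)| = |A(e)| + |B(e)| − 1`.  Thus we can apply KST to `A(e) + B(e) = (A + B) ∖ γ`
with `γ ∈ A + B`.  Hence, since `⟨−γ′ + \overline{A + B}⟩ = G` for `γ′ ∈ \overline{A + B}` (eq. (46)),
and since `d⊆(\overline{A + B}, QP) ≥ 2` (eq. (49)), it follows that the quasi-period from KST must be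
`G`.  Hence from KST it follows that either `d⊆(\overline{A + B}, AP) ≤ 1` or else `|A + B| ≥ |G|`,
both contradictions (to (51) or Claim 10). … Suppose `(A(e), B(e))` is extendible.  Hence we can apply
KST to `(A(e) ∪ {α}) + (B(e) ∪ {β}) = A + B`.  As in the previous paragraph, the quasi-period from KST
must be `G`, whence either `d⊆(\overline{A + B}, AP) ≤ 0` or else `|\overline{A + B}| ≤ 1`, both
contradictions»  (overlines restored from the arXiv version; the same step is quoted in Subcase 4,
p. 32: «the arguments from the analogous part of Subcase 2 complete the proof»).

HOW IT IS MIRRORED.  For a Kemperman decomposition (quasi-period `L`) of a pair `(X, Y)` with sumset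
`C = X + Y`: `C` has a quasi-periodic decomposition with quasi-period `L`
(`IsKempermanDecompI.isQuasiPeriodicDecomp_add`), hence so has `\overline{C}`
(`IsQuasiPeriodicDecomp.exists_compl`); if its periodic part is nonempty, `\overline{C}` is
quasi-periodic and a set `W ⊆ \overline{C}` with `|\overline{C} ∖ W| ≤ 1` has `d⊆(W, 𝒬𝒫) ≤ 1`;
otherwise `\overline{C}` lies in one `L`-coset and `⟨−w₀ + W⟩ = G` forces `L = G`
(`IsKempermanDecompI.eq_top_of_compl`).  With `L = G` the pair is elementary: type (I) is excluded by
`|X|, |Y| ≥ 2`; type (II) makes `C` a progression (`IsAP.add`), which is either a full `⟨d⟩`-coset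
(periodic — excluded: `C` is aperiodic) or a genuine quasi-progression, whence `\overline{C}` is one
(`isQuasiProgression_compl_iff`) and `d⊆(W, 𝒬𝒜𝒫_d) ≤ 1`; types (III), (IV) give `|C| ≥ |G| − 1`, so
`|W| ≤ 1` (`IsKempermanDecompI.false_of_compl`; for (III)/(IV) the coset of `X ∋ 0`, `⟨X⟩ = G`, is all of
`G`).  The wrapper `false_of_critical_of_compl` starts from the critical pair itself (KST =
`exists_isKempermanDecompI_of_not_isPeriodic'`).

WHAT THIS FILE IS NOT: no new definitions, no named facts; Subcase 2 itself (which also needs the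
induction hypothesis for `(A(e), B(e))`, Lemma 5.4 and Corollary 4.3) is not assembled here.

## References
* D. J. Grynkiewicz, *A step beyond Kemperman's structure theorem*, Mathematika 55 (2009) 67–114,
  doi:10.1112/S0025579300000966; §6 Subcase 2 (p. 31), Subcase 4 (p. 32), §2 KST (held
  `paper:doi-10-1112-s0025579300000966`, pp. 31–32 read 2026-08-29) [cite: Grynkiewicz2009, §6 Subcase 2].
* J. H. B. Kemperman, *On small sumsets in an abelian group*, Acta Math. 103 (1960) 63–88, Thm 5.1
  [cite: Kemperman1960, Thm 5.1].
-/

namespace Literature.Combinatorics.Additive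

open Finset
open scoped Pointwise

universe u

variable {G : Type u} [AddCommGroup G] [DecidableEq G]

namespace IsKempermanDecompI

/-- «since `⟨−γ′ + \overline{A + B}⟩ = G` … and since `d⊆(\overline{A + B}, QP) ≥ 2`, it follows that
the quasi-period from KST must be `G`»: a Kemperman decomposition of `(X, Y)` such that the complement
of `X + Y` contains, up to one element, a set `W` with `⟨−w₀ + W⟩ = G` (`w₀ ∈ W`) and `d⊆(W, 𝒬𝒫) ≥ 2`
has quasi-period `G` and empty periodic parts. [cite: Grynkiewicz2009, §6 Subcase 2 (p. 31)] -/
theorem eq_top_of_compl [Fintype G] {L : AddSubgroup G} {X Y X₁ X₀ Y₁ Y₀ W : Finset G} {w₀ : G}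
    (hK : IsKempermanDecompI L X Y X₁ X₀ Y₁ Y₀) (hW : W ⊆ (X + Y)ᶜ) (h1 : #((X + Y)ᶜ \ W) ≤ 1)
    (hw₀ : w₀ ∈ W) (hgen : AddSubgroup.closure (((-w₀) +ᵥ W : Finset G) : Set G) = ⊤)
    (h49 : 2 ≤ subsetDist W {P | IsQuasiPeriodic P}) :
    L = ⊤ ∧ X₁ = ∅ ∧ X₀ = X ∧ Y₁ = ∅ ∧ Y₀ = Y := by
  classical
  obtain ⟨C₁, C₀, hd⟩ := hK.isQuasiPeriodicDecomp_add.exists_compl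
  have hC₁ : C₁ = ∅ := by
    by_contra hne
    have hqp : IsQuasiPeriodic (X + Y)ᶜ := ⟨L, C₁, C₀, hd, nonempty_iff_ne_empty.2 hne⟩
    have h := h49.trans (subsetDist_le (𝒮 := {P | IsQuasiPeriodic P}) hqp hW)
    norm_cast at h
    omega
  have hC₀ : C₀ = (X + Y)ᶜ := by
    have := hd.union_eq
    rwa [hC₁, empty_union] at this
  have hLtop : L = ⊤ := by
    rw [eq_top_iff, ← hgen]
    refine (AddSubgroup.closure_le L).2 fun z hz => ?_
    rw [mem_coe] at hz
    obtain ⟨w, hw, rfl⟩ := mem_vadd_finset.1 hz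
    rw [vadd_eq_add, neg_add_eq_sub]
    exact hd.sub_mem w (by rw [hC₀]; exact hW hw) w₀ (by rw [hC₀]; exact hW hw₀)
  subst hLtop
  have hX₁ : X₁ = ∅ := by
    by_contra hne
    obtain ⟨y, hy⟩ := nonempty_iff_ne_empty.2 hne
    obtain ⟨z, hz⟩ := hK.left_nonempty
    have hz₁ : z ∈ X₁ := by
      have := hK.decomp_left.periodic.add_mem (AddSubgroup.mem_top (z - y)) hy
      rwa [sub_add_cancel] at this
    exact disjoint_left.1 hK.decomp_left.disjoint hz₁ hz
  have hY₁ : Y₁ = ∅ := by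
    by_contra hne
    obtain ⟨y, hy⟩ := nonempty_iff_ne_empty.2 hne
    obtain ⟨z, hz⟩ := hK.right_nonempty
    have hz₁ : z ∈ Y₁ := by
      have := hK.decomp_right.periodic.add_mem (AddSubgroup.mem_top (z - y)) hy
      rwa [sub_add_cancel] at this
    exact disjoint_left.1 hK.decomp_right.disjoint hz₁ hz
  have hX₀ : X₀ = X := by
    have := hK.decomp_left.union_eq
    rwa [hX₁, empty_union] at this
  have hY₀ : Y₀ = Y := by
    have := hK.decomp_right.union_eq
    rwa [hY₁, empty_union] at this
  exact ⟨rfl, hX₁, hX₀, hY₁, hY₀⟩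

/-- «Hence from KST it follows that either `d⊆(\overline{A + B}, AP) ≤ 1` or else `|A + B| ≥ |G|`, both
contradictions»: with the hypotheses of `eq_top_of_compl`, and moreover `0 ∈ X`, `⟨X⟩ = G`,
`|X|, |Y| ≥ 2`, `|X + Y| = |X| + |Y| − 1`, `X + Y` aperiodic, `|W| ≥ 2` and `d⊆(W, 𝒬𝒜𝒫_d) ≥ 2` for all
`d ≠ 0`, the Kemperman decomposition cannot exist. [cite: Grynkiewicz2009, §6 Subcase 2 (p. 31)] -/
theorem false_of_compl [Fintype G] {L : AddSubgroup G} {X Y X₁ X₀ Y₁ Y₀ W : Finset G} {w₀ : G}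
    (hK : IsKempermanDecompI L X Y X₁ X₀ Y₁ Y₀) (h0X : (0 : G) ∈ X)
    (hgenX : AddSubgroup.closure (X : Set G) = ⊤) (hX2 : 2 ≤ #X) (hY2 : 2 ≤ #Y)
    (hcrit : #(X + Y) + 1 = #X + #Y) (haper : (X + Y).addStab = {0})
    (hW : W ⊆ (X + Y)ᶜ) (h1 : #((X + Y)ᶜ \ W) ≤ 1) (hW2 : 2 ≤ #W)
    (hw₀ : w₀ ∈ W) (hgen : AddSubgroup.closure (((-w₀) +ᵥ W : Finset G) : Set G) = ⊤)
    (h49 : 2 ≤ subsetDist W {P | IsQuasiPeriodic P})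
    (h51 : ∀ d : G, d ≠ 0 → 2 ≤ subsetDist W {P | IsQuasiProgression d P}) : False := by
  obtain ⟨hL, -, hX₀, -, hY₀⟩ := hK.eq_top_of_compl hW h1 hw₀ hgen h49
  have hE := hK.elementary
  rw [hX₀, hY₀] at hE
  have hCne : (X + Y).Nonempty := (card_pos.1 (by omega : 0 < #X)).add (card_pos.1 (by omega))
  have hcardG : #(X + Y) + #(X + Y)ᶜ = Fintype.card G := by
    rw [card_compl]; have := card_le_univ (X + Y); omega
  have hWle : #W ≤ #(X + Y)ᶜ := card_le_card hW
  rcases hE with hI | hII | hIII | hIV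
  · have := hI.2.2
    omega
  · -- type (II): `X + Y` is a progression with difference `d`
    obtain ⟨-, -, d, hXd, hYd, -⟩ := hII
    have hd : d ≠ 0 := hXd.ne_zero (by omega)
    have hC : IsAP (X + Y) d := hXd.add hYd hcrit
    obtain ⟨c, hCeq⟩ := hC
    set N := #(X + Y) with hN
    by_cases hdist : ∀ k, 1 ≤ k → k ≤ N → k • d ≠ 0
    · -- a genuine quasi-progression: so is the complement
      have hq : IsQuasiProgression d (X + Y) := by
        have hc := Grynkiewicz2009.card_apFinset_succ_of_forall_nsmul_ne (s := c) hdist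
        obtain ⟨m, hm⟩ : ∃ m, N = m + 1 := ⟨N - 1, by have := hCne.card_pos; omega⟩
        rw [hCeq, hm]
        rw [hm] at hc
        exact isQuasiProgression_apFinset (by omega) hc
      have hqc : IsQuasiProgression d (X + Y)ᶜ := isQuasiProgression_compl_iff.2 hq
      have h := (h51 d hd).trans (subsetDist_le (𝒮 := {P | IsQuasiProgression d P}) hqc hW)
      norm_cast at h
      omega
    · -- a full `⟨d⟩`-coset: `X + Y` would be periodic
      push Not at hdist
      obtain ⟨k, hk1, hkN, hk⟩ := hdist
      have hper : d +ᵥ (X + Y) = X + Y := by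
        rw [hCeq]
        exact Grynkiewicz2009.vadd_apFinset_eq_of_nsmul_eq_zero hk1 hkN hk
      have hmem : d ∈ (X + Y).addStab := (mem_addStab hCne).2 hper
      rw [haper, mem_singleton] at hmem
      exact hd hmem
  · obtain ⟨K, a, b, -, -, hXK, -, hcard, -⟩ := hIII
    have hKtop : K = ⊤ := Grynkiewicz2009.eq_top_of_coset_of_closure_eq_top h0X hgenX hXK
    subst hKtop
    rw [AddSubgroup.card_top, Nat.card_eq_fintype_card] at hcard
    omega
  · obtain ⟨K, a, b, g, -, -, hXK, -, -, -, -, hiff⟩ := hIV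
    have hKtop : K = ⊤ := Grynkiewicz2009.eq_top_of_coset_of_closure_eq_top h0X hgenX hXK
    subst hKtop
    have hXeq : X = (Yᶜ).image (fun y => g - y) := by
      ext x
      rw [mem_image]
      constructor
      · intro hx
        exact ⟨g - x, mem_compl.2 ((hiff x).1 hx).2, sub_sub_cancel g x⟩
      · rintro ⟨y, hy, rfl⟩
        exact (hiff _).2 ⟨AddSubgroup.mem_top _, by rw [sub_sub_cancel]; exact mem_compl.1 hy⟩
    have hcardX : #X = Fintype.card G - #Y := by
      rw [hXeq, card_image_of_injective _ sub_right_injective, card_compl]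
    have := card_le_univ Y
    omega

end IsKempermanDecompI

namespace Grynkiewicz2009

/-- **The Subcase-2 exclusion** (print p. 31, both paragraphs).  `G` finite; a pair `(X, Y)` with `0 ∈ X`,
`⟨X⟩ = G`, `|X|, |Y| ≥ 2`, `|X + Y| = |X| + |Y| − 1` and `X + Y` aperiodic, whose sumset's complement
contains, up to at most one element, a set `W` with `|W| ≥ 2`, `⟨−w₀ + W⟩ = G` (`w₀ ∈ W`; display (46)),
`d⊆(W, 𝒬𝒫) ≥ 2` (display (49)) and `d⊆(W, 𝒬𝒜𝒫_d) ≥ 2` for all `d ≠ 0` (display (51)/(50)) — does not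
exist. [cite: Grynkiewicz2009, §6 Subcase 2 (p. 31)] -/
theorem false_of_critical_of_compl [Fintype G] {X Y W : Finset G} {w₀ : G} (h0X : (0 : G) ∈ X)
    (hgenX : AddSubgroup.closure (X : Set G) = ⊤) (hX2 : 2 ≤ #X) (hY2 : 2 ≤ #Y)
    (hcrit : #(X + Y) + 1 = #X + #Y) (haper : (X + Y).addStab = {0})
    (hW : W ⊆ (X + Y)ᶜ) (h1 : #((X + Y)ᶜ \ W) ≤ 1) (hW2 : 2 ≤ #W)
    (hw₀ : w₀ ∈ W) (hgen : AddSubgroup.closure (((-w₀) +ᵥ W : Finset G) : Set G) = ⊤)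
    (h49 : 2 ≤ subsetDist W {P | IsQuasiPeriodic P})
    (h51 : ∀ d : G, d ≠ 0 → 2 ≤ subsetDist W {P | IsQuasiProgression d P}) : False := by
  have hXne : X.Nonempty := ⟨0, h0X⟩
  have hYne : Y.Nonempty := card_pos.1 (by omega)
  haveI : Nontrivial G := by
    rw [← Fintype.one_lt_card_iff_nontrivial]
    exact lt_of_lt_of_le (by omega : 1 < #X) (card_le_univ X)
  have hnp : ¬ IsPeriodic (X + Y) := fun h => (isPeriodic_iff_addStab_ne (hXne.add hYne)).1 h haper
  obtain ⟨L, X₁, X₀, Y₁, Y₀, hK⟩ := exists_isKempermanDecompI_of_not_isPeriodic' hXne hYne hcrit.le hnp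
  exact hK.false_of_compl h0X hgenX hX2 hY2 hcrit haper hW h1 hW2 hw₀ hgen h49 h51

end Grynkiewicz2009

end Literature.Combinatorics.Additive
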